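import Summits.ResolutionOfSingularities.ResolutionOfSingularities.Theorems.HomologicalConductorSurfaceTerminationGenusTwoRegularLeray
import Mathlib.AlgebraicGeometry.ZariskisMainTheorem
import HarnessLib

/-!
# Crux `NoZenoR` (stmt-ResolutionOfSingularities-19943) — Lipman (1.2) 1), toward the binder-free GLOBAL form:
# `R¹ρ_*𝒪_Z = 0` at every point with FINITE fibre (Čech / base-change form)

Route `ResolutionOfSingularities/HomologicalConductor` (cell decomp-res, hand leafhand-res-homologicalconduct-12 g1).
OURS: AI-written, weaker than expert review; nothing here is a statement of the manuscript under review (Hironaka 2017).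
SUPPORT level (`--supports stmt-19943`), counted 0.  Def-free, FACT-FREE.

Lipman's proof of (1.2) 1) (p. 200, footnote (1)) uses «`R¹h_*(𝒪_Z)` has support of dimension `≤ 0`»: over a point `x`
with finite fibre a proper `ρ` is finite on a neighbourhood (Zariski's Main Theorem, Mathlib
`exists_isFinite_morphismRestrict_of_finite_preimage_singleton`, Stacks 02UP), so the base change
`Z ×_X Spec 𝒪_{X,x} → Spec 𝒪_{X,x}` is finite, its source affine, and its Čech `H¹` vanishes.  This is the pointwise input
((L1) of `…SurfaceTerminationGenusTwoRegularLeray`) at ALL finite-fibre points — regular or not — which the «good cover» of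
the cohomological core (`…NoZenoRationalAscentRegularBase.hasRationalSingularity_of_chart_of_forall_stalk`) consumes; what then
remains of the binder-free form of (1.2) 1) is the finiteness of the set of points with infinite fibre.

* `hasTrivialCechH1_pullback_snd_fromSpecStalk_of_finite_preimage` — `ρ : Z → X` proper, `ρ⁻¹{x}` finite ⇒ `Ȟ¹ = 0` on
  `Z ×_X Spec 𝒪_{X,x}` (every finite affine open cover).

No crux, kill test or summit statement is proved; resolution of singularities in positive characteristic is NOT proved.

## References
* J. Lipman, *Rational singularities …*, Publ. Math. IHÉS 36 (1969): proof of Prop. (1.2) 1), p. 200, footnote (1). [Lipman1969]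
* The Stacks Project, Tag 02UP (proper + finite fibre ⇒ finite over a neighbourhood). [StacksProject]
-/

-- single-problem summit: the doubled namespace component `ResolutionOfSingularities` is forced
set_option linter.dupNamespace false

noncomputable section

namespace Summit.ResolutionOfSingularities.ResolutionOfSingularities.Theorems.NoZeno.RationalAscent

open CategoryTheory CategoryTheory.Limits AlgebraicGeometry TopologicalSpace IsLocalRing
open Literature.AlgebraicGeometry.Resolution Literature.AlgebraicGeometry.Morphisms

universe u

set_option maxHeartbeats 400000 in
/-- **`R¹ρ_*𝒪_Z = 0` at a point with finite fibre** (Čech / base-change form): for `ρ : Z → X` proper and `x ∈ X` with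
`ρ⁻¹{x}` finite, every finite affine open cover of `Z ×_X Spec 𝒪_{X,x}` has trivial Čech `H¹` of the structure sheaf — the
base change is proper with finite fibre over the closed point, hence finite (Zariski's Main Theorem over the local base, whose
only open neighbourhood of the closed point is everything), hence its source is affine.
[cite: StacksProject, Tag 02UP] [cite: Lipman1969, proof of Proposition (1.2) 1), p. 200 footnote (1)] -/
theorem hasTrivialCechH1_pullback_snd_fromSpecStalk_of_finite_preimage {X Z : Scheme.{u}} (ρ : Z ⟶ X) [IsProper ρ]
    (x : X) (hfin : (ρ ⁻¹' {x}).Finite) :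
    HasTrivialCechH1 (pullback.snd ρ (X.fromSpecStalk x)) := by
  classical
  set g := pullback.snd ρ (X.fromSpecStalk x) with hg
  -- the fibre of `g` over the closed point injects into `ρ⁻¹{x}`
  have hinj : Function.Injective fun p => (pullback.fst ρ (X.fromSpecStalk x) p, g p) :=
    (SurjectiveOnStalks.isEmbedding_pullback ρ (X.fromSpecStalk x)).injective
  let s : Spec (X.presheaf.stalk x) := closedPoint (X.presheaf.stalk x)
  have hfin' : (g ⁻¹' {s}).Finite := by
    refine Set.Finite.of_injOn (f := fun p => (pullback.fst ρ (X.fromSpecStalk x) p, g p))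
      (t := (ρ ⁻¹' {x}) ×ˢ {s}) (fun p hp => ⟨?_, hp⟩) hinj.injOn (hfin.prod (Set.finite_singleton s))
    have hp : g p = s := hp
    show ρ (pullback.fst ρ (X.fromSpecStalk x) p) ∈ ({x} : Set X)
    rw [Set.mem_singleton_iff, ← Scheme.Hom.comp_apply, pullback.condition, Scheme.Hom.comp_apply]
    change X.fromSpecStalk x (g p) = x
    rw [hp]
    exact Scheme.fromSpecStalk_closedPoint
  -- proper with finite fibre over the closed point ⇒ finite over a neighbourhood, which is everything
  obtain ⟨V, hsV, hV⟩ := exists_isFinite_morphismRestrict_of_finite_preimage_singleton g s hfin'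
  have hVtop : V = ⊤ := (IsLocalRing.closedPoint_mem_iff V).mp hsV
  subst hVtop
  haveI : IsFinite g :=
    (IsZariskiLocalAtTarget.iff_of_iSup_eq_top (P := @IsFinite)
      (fun _ : PUnit.{u + 1} => (⊤ : (Spec (X.presheaf.stalk x)).Opens)) iSup_const).mpr fun _ => hV
  haveI : IsAffine (pullback ρ (X.fromSpecStalk x)) := isAffine_of_isAffineHom g
  intro ι _ U hU hcov
  refine ⟨fun a b => ?_⟩
  obtain ⟨za, rfl⟩ := CechH1.mk_surjective _ U a
  obtain ⟨zb, rfl⟩ := CechH1.mk_surjective _ U b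
  have hv := cechH1_affine_vanishing_holds g (isAffineOpen_top _) U hcov
  rw [(CechH1.mk_eq_zero_iff _ U za).mpr (hv za.2), (CechH1.mk_eq_zero_iff _ U zb).mpr (hv zb.2)]

end Summit.ResolutionOfSingularities.ResolutionOfSingularities.Theorems.NoZeno.RationalAscent

end
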